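import Summits.CriticalPhenomena.PercolationContinuityZ3.Theorems.PercNearOneGluingNoHeavyQuantSliceLawSWFlow
import Summits.CriticalPhenomena.PercolationContinuityZ3.Theorems.PercNearOneGluingNoHeavyQuantSliceLawSWPoly
import HarnessLib

/-!
# QUANT lane R8, T-DEC: towards `LawDec.SliceLawSW` — part 3: the ten core-cell inequalities with their denominators restored

builds on p205010 (kernel theorem, internal audit signed; external expert review pending)

Support file (`--supports stmt-CriticalPhenomena-4575`), QUANT lane typer seat prim-quant-stmt (gen 24), rung R8 of
`run/shared/lean/prim/quant/LADDER.md`.  Theorems only (real variables), standard axioms, no sorries.  Part 2 (`…QuantSliceLawSWPoly`) holds the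
polynomial certificates `SliceLawSWCert.poly_*`; this file divides them back by the positive denominators.  Coordinates as in part 2: `0 < ρ < x ≤ g ≤ 1`,
sizes `a, D > 0`, `C = ρD + ag` (`= T′ − 2l`), window mid `C ≤ 2D`; `γ = x² + (1−x)ρ`; masses `m₀ = (1−γ)(1−g)`, `m₁ = (1−γ)g`, `m_d = γ(1−g)`, `m_G = γg`;
rates `u₁ = (x²(D−a) + (1−x)(C−2a))/((1−x)((1+x)(D−a) − (C−2a)))` (pair `(l+a, h)`, light), `u_{0d}` = `(x²D + (1−x)C)/((1−x)((1+x)D − C))` (light) or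
`C/(D − C)` (heavy) (pair `(l, h)` at `T′`), `u_{01} = C/(a − C)` (pair `(l, l+a)`, shallow), `x/(1−x)` (giant).
* deep (`2a < C`): `sw_DA` (I-A), `sw_DAinc`, `sw_DA2H`, `sw_DB` (I-B);  shallow (`C ≤ 2a`): `sw_S_inc_inc`, `sw_S_inc_L`, `sw_S_inc_H`, `sw_S_H_inc`,
  `sw_S_H_L`, `sw_S_H_H` — each `0 ≤ slack` of the corner strategy in the merged-absorber problem (giant + transferred capacity = one absorber charged
  `min(x/(1−x), usage(·, h))`); exact second implementation: quant/prim-quant-stmt-g24/explore/sw_explore.py / sw_merged.py (corner run with a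
  free transfer `t` vs the merged problem, 500 / 500), cell probes sw_cells.py (0 violations).
Part 4 (`…QuantSliceLawSWCore`) turns them into the transfer `t` and the flow, and proves `SliceLawSW`'s core case.

[this work]; memo SINGLE-LAYER-G55 §3b–§3c (census-2 g55; (I-A)/(I-B) proved there by hand).  Nothing here is cited as a published result.  The gluing
rows served [cite: KozmaNitzan2024, Conjecture 3 (p. 15)]; product measure [cite: Grimmett1999, §1.3 p. 10].
-/

noncomputable section

namespace Summit.CriticalPhenomena.PercolationContinuityZ3.Theorems

namespace Quant

open Finset

namespace LawDec

section Cells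

variable (x ρ g a D : ℝ)

set_option maxHeartbeats 4000000 in
set_option maxRecDepth 100000 in
/-- **cell DA (deep, `xD ≤ C`: the pair `(l,h)` is heavy or dead at `T′`): **(I-A)** `γ ≥ u₁m₁ + (x/(1−x))m₀`.** [this work] -/
theorem sw_DA (hx0 : 0 < x) (hx1 : x < 1) (hr0 : 0 < ρ) (hrx : ρ < x) (hxg : x ≤ g) (hg1 : g ≤ 1) (ha0 : 0 < a) (hD0 : 0 < D)
    (hmidW : ρ * D + a * g ≤ 2 * D) (hdeep : 2 * a < ρ * D + a * g) (hside : x * D ≤ ρ * D + a * g) :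
    0 ≤ (x ^ 2 + (1 - x) * ρ) - ((x ^ 2 * (D - a) + (1 - x) * ((ρ * D + a * g) - 2 * a)) / ((1 - x) * ((1 + x) * (D - a) - ((ρ * D + a * g) - 2 * a)))) * ((1 - (x ^ 2 + (1 - x) * ρ)) * g) - (x / (1 - x)) * ((1 - (x ^ 2 + (1 - x) * ρ)) * (1 - g)) := by
  have h1x : 0 < 1 - x := sub_pos.2 hx1
  have hg0 : 0 < g := hx0.trans_le hxg
  have hgam : 0 < x ^ 2 + (1 - x) * ρ := by nlinarith [mul_pos h1x hr0, pow_pos hx0 2]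
  have hgam1 : x ^ 2 + (1 - x) * ρ < 1 := by nlinarith [mul_lt_mul_of_pos_left hrx h1x]
  have hC0 : 0 < ρ * D + a * g := by nlinarith [mul_pos hr0 hD0, mul_pos ha0 hg0]
  have hrD : ρ * D < x * D := mul_lt_mul_of_pos_right hrx hD0
  have hxD : x * D < D := by nlinarith
  have hag : a * g ≤ a := by nlinarith
  have hax : x * a ≤ a * g := by nlinarith
  have hDa : a < D := by nlinarith
  have hadL : ρ * D + a * g - 2 * a ≤ x * (D - a) := by nlinarith [mul_le_mul_of_nonneg_right hrx.le (sub_pos.2 (show a < D by nlinarith)).le]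
  have key := SliceLawSWCert.poly_DA x ρ g a D ha0.le (by linarith) (by linarith) (by linarith) (by linarith) (by linarith) (by linarith) (by linarith) (by linarith) (by linarith) (by linarith)
  have e : ((x ^ 2 + (1 - x) * ρ) - ((x ^ 2 * (D - a) + (1 - x) * ((ρ * D + a * g) - 2 * a)) / ((1 - x) * ((1 + x) * (D - a) - ((ρ * D + a * g) - 2 * a)))) * ((1 - (x ^ 2 + (1 - x) * ρ)) * g) - (x / (1 - x)) * ((1 - (x ^ 2 + (1 - x) * ρ)) * (1 - g))) * ((1 - x) * ((1 + x) * (D - a) - ((ρ * D + a * g) - 2 * a)))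
      = x^3 * g * a - x^3 * g * D - x^3 * a + x^3 * D - x^2 * ρ * g * a + 2 * x^2 * ρ * g * D + x^2 * ρ * a - 2 * x^2 * ρ * D + x^2 * g^2 * a - 3 * x^2 * g * a + 2 * x^2 * a - x * ρ^2 * g * D + x * ρ^2 * D - x * ρ * g^2 * a + 4 * x * ρ * g * a - x * ρ * g * D - 2 * x * ρ * a + x * ρ * D + x * g * D - x * a - x * D + ρ^2 * g * D - ρ^2 * D + ρ * g^2 * a - 3 * ρ * g * a - ρ * g * D + ρ * a + ρ * D - g^2 * a + 2 * g * a := by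
    set C := ρ * D + a * g with hCdef
    set L := (1 + x) * (D - a) - (C - 2 * a) with hLdef
    have hCne : C ≠ 0 := ne_of_gt hC0
    have hLne : L ≠ 0 := ne_of_gt (by rw [hLdef, hCdef]; nlinarith [mul_pos hx0 (sub_pos.2 hDa)])
    have h1xne : (1:ℝ) - x ≠ 0 := h1x.ne'
    have hxne : x ≠ 0 := hx0.ne'
    have hane : a ≠ 0 := ha0.ne'
    field_simp
    simp only [hLdef, hCdef]
    ring
  have hDEN : 0 < ((1 - x) * ((1 + x) * (D - a) - ((ρ * D + a * g) - 2 * a))) := mul_pos h1x (by nlinarith [mul_pos hx0 (sub_pos.2 hDa)])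
  exact (mul_nonneg_iff_of_pos_right hDEN).1 (by rw [e]; exact key)

set_option maxHeartbeats 4000000 in
set_option maxRecDepth 100000 in
/-- **cell DAinc (deep, `D ≤ C`: the low `l` cannot use `h`): `(x/(1−x))m₀ ≤ m_G`.** [this work] -/
theorem sw_DAinc (hx0 : 0 < x) (hx1 : x < 1) (hr0 : 0 < ρ) (hrx : ρ < x) (hxg : x ≤ g) (hg1 : g ≤ 1) (ha0 : 0 < a) (hD0 : 0 < D)
    (_hmidW : ρ * D + a * g ≤ 2 * D) (hdeep : 2 * a < ρ * D + a * g) (hside : D ≤ ρ * D + a * g) :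
    0 ≤ ((x ^ 2 + (1 - x) * ρ) * g) - (x / (1 - x)) * ((1 - (x ^ 2 + (1 - x) * ρ)) * (1 - g)) := by
  have h1x : 0 < 1 - x := sub_pos.2 hx1
  have hg0 : 0 < g := hx0.trans_le hxg
  have hgam : 0 < x ^ 2 + (1 - x) * ρ := by nlinarith [mul_pos h1x hr0, pow_pos hx0 2]
  have hgam1 : x ^ 2 + (1 - x) * ρ < 1 := by nlinarith [mul_lt_mul_of_pos_left hrx h1x]
  have hC0 : 0 < ρ * D + a * g := by nlinarith [mul_pos hr0 hD0, mul_pos ha0 hg0]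
  have hrD : ρ * D < x * D := mul_lt_mul_of_pos_right hrx hD0
  have hxD : x * D < D := by nlinarith
  have hag : a * g ≤ a := by nlinarith
  have hax : x * a ≤ a * g := by nlinarith
  have hDa : a < D := by nlinarith
  have hadL : ρ * D + a * g - 2 * a ≤ x * (D - a) := by nlinarith [mul_le_mul_of_nonneg_right hrx.le (sub_pos.2 (show a < D by nlinarith)).le]
  have key := SliceLawSWCert.poly_DAinc x ρ g a D ha0.le (by linarith) (by linarith) (by linarith) (by linarith) (by linarith) (by linarith) (by linarith) (by linarith) (by linarith) (by linarith)
  have e : (((x ^ 2 + (1 - x) * ρ) * g) - (x / (1 - x)) * ((1 - (x ^ 2 + (1 - x) * ρ)) * (1 - g))) * (a * (1 - x))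
      = -2 * x^3 * g * a + x^3 * a + 2 * x^2 * ρ * g * a - x^2 * ρ * a + x^2 * g * a - 3 * x * ρ * g * a + x * ρ * a + x * g * a - x * a + ρ * g * a := by
    have h1xne : (1:ℝ) - x ≠ 0 := h1x.ne'
    have hxne : x ≠ 0 := hx0.ne'
    have hane : a ≠ 0 := ha0.ne'
    field_simp
    ring
  have hDEN : 0 < (a * (1 - x)) := mul_pos ha0 h1x
  exact (mul_nonneg_iff_of_pos_right hDEN).1 (by rw [e]; exact key)

set_option maxHeartbeats 4000000 in
set_option maxRecDepth 100000 in
/-- **cell DA2H (deep, `xD ≤ C < D`, `l + a` fits into `h`, `l` ships `(m_d − u₁m₁)/u_{0d}` there): `(x/(1−x))(m₀ − (m_d − u₁m₁)/u_{0d}) ≤ m_G`.** [this work] -/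
theorem sw_DA2H (hx0 : 0 < x) (hx1 : x < 1) (hr0 : 0 < ρ) (hrx : ρ < x) (hxg : x ≤ g) (hg1 : g ≤ 1) (ha0 : 0 < a) (hD0 : 0 < D)
    (_hmidW : ρ * D + a * g ≤ 2 * D) (hdeep : 2 * a < ρ * D + a * g) (hCD : ρ * D + a * g < D) (hside : x * D ≤ ρ * D + a * g) (hfit : ((x ^ 2 * (D - a) + (1 - x) * ((ρ * D + a * g) - 2 * a)) / ((1 - x) * ((1 + x) * (D - a) - ((ρ * D + a * g) - 2 * a)))) * ((1 - (x ^ 2 + (1 - x) * ρ)) * g) ≤ ((x ^ 2 + (1 - x) * ρ) * (1 - g))) :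
    0 ≤ ((x ^ 2 + (1 - x) * ρ) * g) - (x / (1 - x)) * (((1 - (x ^ 2 + (1 - x) * ρ)) * (1 - g)) - (((x ^ 2 + (1 - x) * ρ) * (1 - g)) - ((x ^ 2 * (D - a) + (1 - x) * ((ρ * D + a * g) - 2 * a)) / ((1 - x) * ((1 + x) * (D - a) - ((ρ * D + a * g) - 2 * a)))) * ((1 - (x ^ 2 + (1 - x) * ρ)) * g)) / ((ρ * D + a * g) / (D - (ρ * D + a * g)))) := by
  have h1x : 0 < 1 - x := sub_pos.2 hx1
  have hg0 : 0 < g := hx0.trans_le hxg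
  have hgam : 0 < x ^ 2 + (1 - x) * ρ := by nlinarith [mul_pos h1x hr0, pow_pos hx0 2]
  have hgam1 : x ^ 2 + (1 - x) * ρ < 1 := by nlinarith [mul_lt_mul_of_pos_left hrx h1x]
  have hC0 : 0 < ρ * D + a * g := by nlinarith [mul_pos hr0 hD0, mul_pos ha0 hg0]
  have hrD : ρ * D < x * D := mul_lt_mul_of_pos_right hrx hD0
  have hxD : x * D < D := by nlinarith
  have hag : a * g ≤ a := by nlinarith
  have hax : x * a ≤ a * g := by nlinarith
  have hDa : a < D := by nlinarith
  have hadL : ρ * D + a * g - 2 * a ≤ x * (D - a) := by nlinarith [mul_le_mul_of_nonneg_right hrx.le (sub_pos.2 (show a < D by nlinarith)).le]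
  have hfit' : (x ^ 2 * (D - a) + (1 - x) * (ρ * D + a * g - 2 * a)) * ((1 - (x ^ 2 + (1 - x) * ρ)) * g)
      ≤ (x ^ 2 + (1 - x) * ρ) * (1 - g) * ((1 - x) * ((1 + x) * (D - a) - (ρ * D + a * g - 2 * a))) := by
    have hpos : 0 < (1 - x) * ((1 + x) * (D - a) - (ρ * D + a * g - 2 * a)) := mul_pos h1x (by nlinarith [mul_pos hx0 (sub_pos.2 hDa)])
    rw [div_mul_eq_mul_div, div_le_iff₀ hpos] at hfit
    exact hfit
  have key := SliceLawSWCert.poly_DA2H x ρ g a D ha0.le (by linarith) (by linarith) (by linarith) (by linarith) (by linarith) (by linarith) (by linarith) (by linarith) (by linarith) (by linarith) (by linarith) (by linarith) (by linarith) (by linarith) (by linarith) (by linarith) (by linarith) (by linarith) (by linarith) (by linarith) (by linarith) (by linarith)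
  have e : (((x ^ 2 + (1 - x) * ρ) * g) - (x / (1 - x)) * (((1 - (x ^ 2 + (1 - x) * ρ)) * (1 - g)) - (((x ^ 2 + (1 - x) * ρ) * (1 - g)) - ((x ^ 2 * (D - a) + (1 - x) * ((ρ * D + a * g) - 2 * a)) / ((1 - x) * ((1 + x) * (D - a) - ((ρ * D + a * g) - 2 * a)))) * ((1 - (x ^ 2 + (1 - x) * ρ)) * g)) / ((ρ * D + a * g) / (D - (ρ * D + a * g))))) * ((1 - x) ^ 2 * (ρ * D + a * g) * ((1 + x) * (D - a) - ((ρ * D + a * g) - 2 * a)))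
      = -2 * x^5 * g * a * D + 2 * x^5 * g * D^2 + x^5 * a * D - x^5 * D^2 + 3 * x^4 * ρ * g * a * D - 5 * x^4 * ρ * g * D^2 - x^4 * ρ * a * D + 2 * x^4 * ρ * D^2 + x^4 * g^2 * a^2 - 3 * x^4 * g^2 * a * D + 5 * x^4 * g * a * D - 2 * x^4 * a * D - x^3 * ρ^2 * g * a * D + 4 * x^3 * ρ^2 * g * D^2 - x^3 * ρ^2 * D^2 - x^3 * ρ * g^2 * a^2 + 5 * x^3 * ρ * g^2 * a * D - 8 * x^3 * ρ * g * a * D + 3 * x^3 * ρ * g * D^2 + 2 * x^3 * ρ * a * D - x^3 * ρ * D^2 + x^3 * g^3 * a^2 - x^3 * g^2 * a^2 + x^3 * g^2 * a * D - x^3 * g * a^2 - 2 * x^3 * g * a * D - 2 * x^3 * g * D^2 + x^3 * a * D + x^3 * D^2 - x^2 * ρ^3 * g * D^2 - 2 * x^2 * ρ^2 * g^2 * a * D + 2 * x^2 * ρ^2 * g * a * D - 5 * x^2 * ρ^2 * g * D^2 + x^2 * ρ^2 * D^2 - x^2 * ρ * g^3 * a^2 + 2 * x^2 * ρ * g^2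 * a^2 - 6 * x^2 * ρ * g^2 * a * D + 8 * x^2 * ρ * g * a * D + 3 * x^2 * ρ * g * D^2 - x^2 * ρ * a * D - x^2 * ρ * D^2 - x^2 * g^3 * a^2 + 2 * x^2 * g^2 * a * D + 2 * x^2 * g * a^2 - 2 * x^2 * g * a * D + 2 * x * ρ^3 * g * D^2 + 4 * x * ρ^2 * g^2 * a * D - 2 * x * ρ^2 * g * a * D + 2 * x * ρ * g^3 * a^2 - 2 * x * ρ * g^2 * a^2 - 3 * x * ρ * g * a * D - x * ρ * g * D^2 - x * g * a^2 + x * g * a * D - ρ^3 * g * D^2 - 2 * ρ^2 * g^2 * a * D + ρ^2 * g * a * D + ρ^2 * g * D^2 - ρ * g^3 * a^2 + ρ * g^2 * a^2 + ρ * g^2 * a * D := by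
    set C := ρ * D + a * g with hCdef
    set L := (1 + x) * (D - a) - (C - 2 * a) with hLdef
    set E := D - C with hEdef
    have hCne : C ≠ 0 := ne_of_gt hC0
    have hLne : L ≠ 0 := ne_of_gt (by rw [hLdef, hCdef]; nlinarith [mul_pos hx0 (sub_pos.2 hDa)])
    have hEne : E ≠ 0 := ne_of_gt (by rw [hEdef, hCdef]; linarith)
    have h1xne : (1:ℝ) - x ≠ 0 := h1x.ne'
    have hxne : x ≠ 0 := hx0.ne'
    have hane : a ≠ 0 := ha0.ne'
    field_simp
    simp only [hLdef, hEdef, hCdef]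
    ring
  have hDEN : 0 < ((1 - x) ^ 2 * (ρ * D + a * g) * ((1 + x) * (D - a) - ((ρ * D + a * g) - 2 * a))) := mul_pos (mul_pos (pow_pos h1x 2) hC0) (by nlinarith [mul_pos hx0 (sub_pos.2 hDa)])
  exact (mul_nonneg_iff_of_pos_right hDEN).1 (by rw [e]; exact key)

set_option maxHeartbeats 4000000 in
set_option maxRecDepth 100000 in
/-- **cell DB (deep, `C < xD`: the pair `(l,h)` is light at `T′`): **(I-B)** `γ ≥ u₁m₁ + u_{0d}m₀`.** [this work] -/
theorem sw_DB (hx0 : 0 < x) (hx1 : x < 1) (hr0 : 0 < ρ) (hrx : ρ < x) (hxg : x ≤ g) (hg1 : g ≤ 1) (ha0 : 0 < a) (hD0 : 0 < D)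
    (_hmidW : ρ * D + a * g ≤ 2 * D) (hdeep : 2 * a < ρ * D + a * g) (hside : ρ * D + a * g ≤ x * D) :
    0 ≤ (x ^ 2 + (1 - x) * ρ) - ((x ^ 2 * (D - a) + (1 - x) * ((ρ * D + a * g) - 2 * a)) / ((1 - x) * ((1 + x) * (D - a) - ((ρ * D + a * g) - 2 * a)))) * ((1 - (x ^ 2 + (1 - x) * ρ)) * g) - ((x ^ 2 * D + (1 - x) * (ρ * D + a * g)) / ((1 - x) * ((1 + x) * D - (ρ * D + a * g)))) * ((1 - (x ^ 2 + (1 - x) * ρ)) * (1 - g)) := by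
  have h1x : 0 < 1 - x := sub_pos.2 hx1
  have hg0 : 0 < g := hx0.trans_le hxg
  have hgam : 0 < x ^ 2 + (1 - x) * ρ := by nlinarith [mul_pos h1x hr0, pow_pos hx0 2]
  have hgam1 : x ^ 2 + (1 - x) * ρ < 1 := by nlinarith [mul_lt_mul_of_pos_left hrx h1x]
  have hC0 : 0 < ρ * D + a * g := by nlinarith [mul_pos hr0 hD0, mul_pos ha0 hg0]
  have hrD : ρ * D < x * D := mul_lt_mul_of_pos_right hrx hD0
  have hxD : x * D < D := by nlinarith
  have hag : a * g ≤ a := by nlinarith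
  have hax : x * a ≤ a * g := by nlinarith
  have hDa : a < D := by nlinarith
  have hadL : ρ * D + a * g - 2 * a ≤ x * (D - a) := by nlinarith [mul_le_mul_of_nonneg_right hrx.le (sub_pos.2 (show a < D by nlinarith)).le]
  have key := SliceLawSWCert.poly_DB x ρ g a D ha0.le (by linarith) (by linarith) (by linarith) (by linarith) (by linarith)
  have e : ((x ^ 2 + (1 - x) * ρ) - ((x ^ 2 * (D - a) + (1 - x) * ((ρ * D + a * g) - 2 * a)) / ((1 - x) * ((1 + x) * (D - a) - ((ρ * D + a * g) - 2 * a)))) * ((1 - (x ^ 2 + (1 - x) * ρ)) * g) - ((x ^ 2 * D + (1 - x) * (ρ * D + a * g)) / ((1 - x) * ((1 + x) * D - (ρ * D + a * g)))) * ((1 - (x ^ 2 + (1 - x) * ρ)) * (1 - g))) * ((1 - x) * ((1 + x) * D - (ρ * D + a * g)) * ((1 + x) * (D - a) - ((ρ * D + a * g) - 2 * a)))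
      = x^2 * ρ * g * a * D + x^2 * g^2 * a^2 - x^2 * g * a^2 - x^2 * g * a * D - x * ρ^2 * g * a * D - x * ρ * g^2 * a^2 + x * ρ * g * a * D - x * g^2 * a^2 + 2 * x * g * a^2 + ρ^2 * g * a * D + ρ * g^2 * a^2 - 2 * ρ * g * a * D - g * a^2 + g * a * D := by
    set C := ρ * D + a * g with hCdef
    set L := (1 + x) * (D - a) - (C - 2 * a) with hLdef
    set L0 := (1 + x) * D - C with hL0def
    have hCne : C ≠ 0 := ne_of_gt hC0
    have hLne : L ≠ 0 := ne_of_gt (by rw [hLdef, hCdef]; nlinarith [mul_pos hx0 (sub_pos.2 hDa)])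
    have hL0ne : L0 ≠ 0 := ne_of_gt (by rw [hL0def, hCdef]; nlinarith [mul_pos hx0 hD0])
    have h1xne : (1:ℝ) - x ≠ 0 := h1x.ne'
    have hxne : x ≠ 0 := hx0.ne'
    have hane : a ≠ 0 := ha0.ne'
    field_simp
    simp only [hLdef, hL0def, hCdef]
    ring
  have hDEN : 0 < ((1 - x) * ((1 + x) * D - (ρ * D + a * g)) * ((1 + x) * (D - a) - ((ρ * D + a * g) - 2 * a))) := mul_pos (mul_pos h1x (by nlinarith [mul_pos hx0 hD0])) (by nlinarith [mul_pos hx0 (sub_pos.2 hDa)])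
  exact (mul_nonneg_iff_of_pos_right hDEN).1 (by rw [e]; exact key)

set_option maxHeartbeats 4000000 in
set_option maxRecDepth 100000 in
/-- **cell S_inc_inc (shallow, `a ≤ C`, `D ≤ C`: only the giant absorbs): `m₀ ≤ m_G/(x/(1−x))`.** [this work] -/
theorem sw_S_inc_inc (hx0 : 0 < x) (hx1 : x < 1) (hr0 : 0 < ρ) (hrx : ρ < x) (hxg : x ≤ g) (hg1 : g ≤ 1) (ha0 : 0 < a) (hD0 : 0 < D)
    (_hmidW : ρ * D + a * g ≤ 2 * D) (_hsh : ρ * D + a * g ≤ 2 * a) (hCa : a ≤ ρ * D + a * g) (hCD : D ≤ ρ * D + a * g) :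
    0 ≤ ((x ^ 2 + (1 - x) * ρ) * g) / (x / (1 - x)) - ((1 - (x ^ 2 + (1 - x) * ρ)) * (1 - g)) := by
  have h1x : 0 < 1 - x := sub_pos.2 hx1
  have hg0 : 0 < g := hx0.trans_le hxg
  have hgam : 0 < x ^ 2 + (1 - x) * ρ := by nlinarith [mul_pos h1x hr0, pow_pos hx0 2]
  have hgam1 : x ^ 2 + (1 - x) * ρ < 1 := by nlinarith [mul_lt_mul_of_pos_left hrx h1x]
  have hC0 : 0 < ρ * D + a * g := by nlinarith [mul_pos hr0 hD0, mul_pos ha0 hg0]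
  have hrD : ρ * D < x * D := mul_lt_mul_of_pos_right hrx hD0
  have hxD : x * D < D := by nlinarith
  have hag : a * g ≤ a := by nlinarith
  have hax : x * a ≤ a * g := by nlinarith
  have hrg : 1 ≤ ρ + g := by
    have h1 : a * (1 - g) ≤ ρ * D := by linarith
    have h2 : D * (1 - ρ) ≤ a * g := by nlinarith
    by_contra hn
    push Not at hn
    have h3 : a * (1 - g) * (1 - ρ) ≤ ρ * (a * g) := by nlinarith [mul_le_mul_of_nonneg_right h1 (by linarith : (0:ℝ) ≤ 1 - ρ), mul_le_mul_of_nonneg_left h2 hr0.le]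
    nlinarith [mul_pos ha0 (by nlinarith : (0:ℝ) < (1 - g) * (1 - ρ) - ρ * g)]
  have key := SliceLawSWCert.poly_S_inc_inc x ρ g (by linarith) (by linarith) (by linarith) (by linarith) (by linarith) (by linarith) (by linarith)
  have e : (((x ^ 2 + (1 - x) * ρ) * g) / (x / (1 - x)) - ((1 - (x ^ 2 + (1 - x) * ρ)) * (1 - g))) * x
      = -2 * x^3 * g + x^3 + 2 * x^2 * ρ * g - x^2 * ρ + x^2 * g - 3 * x * ρ * g + x * ρ + x * g - x + ρ * g := by
    have h1xne : (1:ℝ) - x ≠ 0 := h1x.ne'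
    have hxne : x ≠ 0 := hx0.ne'
    have hane : a ≠ 0 := ha0.ne'
    field_simp
    ring
  have hDEN : 0 < x := hx0
  exact (mul_nonneg_iff_of_pos_right hDEN).1 (by rw [e]; exact key)

set_option maxHeartbeats 4000000 in
set_option maxRecDepth 100000 in
/-- **cell S_inc_L (shallow, `a ≤ C`, `(l,h)` light at `T′`: everything into `h` with the full transfer): `m₀ ≤ γ/u_{0d}`.** [this work] -/
theorem sw_S_inc_L (hx0 : 0 < x) (hx1 : x < 1) (hr0 : 0 < ρ) (hrx : ρ < x) (hxg : x ≤ g) (hg1 : g ≤ 1) (ha0 : 0 < a) (hD0 : 0 < D)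
    (_hmidW : ρ * D + a * g ≤ 2 * D) (hsh : ρ * D + a * g ≤ 2 * a) (hCa : a ≤ ρ * D + a * g) (hside : ρ * D + a * g ≤ x * D) :
    0 ≤ (x ^ 2 + (1 - x) * ρ) / ((x ^ 2 * D + (1 - x) * (ρ * D + a * g)) / ((1 - x) * ((1 + x) * D - (ρ * D + a * g)))) - ((1 - (x ^ 2 + (1 - x) * ρ)) * (1 - g)) := by
  have h1x : 0 < 1 - x := sub_pos.2 hx1
  have hg0 : 0 < g := hx0.trans_le hxg
  have hgam : 0 < x ^ 2 + (1 - x) * ρ := by nlinarith [mul_pos h1x hr0, pow_pos hx0 2]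
  have hgam1 : x ^ 2 + (1 - x) * ρ < 1 := by nlinarith [mul_lt_mul_of_pos_left hrx h1x]
  have hC0 : 0 < ρ * D + a * g := by nlinarith [mul_pos hr0 hD0, mul_pos ha0 hg0]
  have hrD : ρ * D < x * D := mul_lt_mul_of_pos_right hrx hD0
  have hxD : x * D < D := by nlinarith
  have hag : a * g ≤ a := by nlinarith
  have hax : x * a ≤ a * g := by nlinarith
  have key := SliceLawSWCert.poly_S_inc_L x ρ g a D (by linarith) (by linarith) (by linarith) (by linarith) (by linarith) (by linarith) (by linarith) (by linarith) (by linarith) (by linarith) (by linarith) (by linarith)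
  have e : ((x ^ 2 + (1 - x) * ρ) / ((x ^ 2 * D + (1 - x) * (ρ * D + a * g)) / ((1 - x) * ((1 + x) * D - (ρ * D + a * g)))) - ((1 - (x ^ 2 + (1 - x) * ρ)) * (1 - g))) * (x ^ 2 * D + (1 - x) * (ρ * D + a * g))
      = -x^4 * g * D + 2 * x^3 * ρ * g * D + x^3 * g^2 * a - x^2 * ρ^2 * g * D - x^2 * ρ * g^2 * a - 2 * x^2 * ρ * g * D - x^2 * g^2 * a + x^2 * g * D + 2 * x * ρ^2 * g * D + 2 * x * ρ * g^2 * a - x * ρ * g * D - x * g^2 * a + x * g * a - ρ^2 * g * D - ρ * g^2 * a + ρ * g * D + g^2 * a - g * a := by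
    set C := ρ * D + a * g with hCdef
    set N0 := x ^ 2 * D + (1 - x) * C with hN0def
    set L0 := (1 + x) * D - C with hL0def
    have hCne : C ≠ 0 := ne_of_gt hC0
    have hN0ne : N0 ≠ 0 := ne_of_gt (by rw [hN0def, hCdef]; nlinarith [mul_pos (pow_pos hx0 2) hD0, mul_pos h1x hC0])
    have hL0ne : L0 ≠ 0 := ne_of_gt (by rw [hL0def, hCdef]; nlinarith [mul_pos hx0 hD0])
    have h1xne : (1:ℝ) - x ≠ 0 := h1x.ne'
    have hxne : x ≠ 0 := hx0.ne'
    have hane : a ≠ 0 := ha0.ne'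
    field_simp
    simp only [hN0def, hL0def, hCdef]
    ring
  have hDEN : 0 < (x ^ 2 * D + (1 - x) * (ρ * D + a * g)) := by nlinarith [mul_pos (pow_pos hx0 2) hD0, mul_pos h1x hC0]
  exact (mul_nonneg_iff_of_pos_right hDEN).1 (by rw [e]; exact key)

set_option maxHeartbeats 4000000 in
set_option maxRecDepth 100000 in
/-- **cell S_inc_H (shallow, `a ≤ C`, `(l,h)` heavy at `T′`, no transfer): `m₀ ≤ m_d/u_{0d} + m_G/(x/(1−x))`.** [this work] -/
theorem sw_S_inc_H (hx0 : 0 < x) (hx1 : x < 1) (hr0 : 0 < ρ) (hrx : ρ < x) (hxg : x ≤ g) (hg1 : g ≤ 1) (ha0 : 0 < a) (hD0 : 0 < D)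
    (_hmidW : ρ * D + a * g ≤ 2 * D) (_hsh : ρ * D + a * g ≤ 2 * a) (hCa : a ≤ ρ * D + a * g) (hCD : ρ * D + a * g < D) (hside : x * D ≤ ρ * D + a * g) :
    0 ≤ ((x ^ 2 + (1 - x) * ρ) * (1 - g)) / ((ρ * D + a * g) / (D - (ρ * D + a * g))) + ((x ^ 2 + (1 - x) * ρ) * g) / (x / (1 - x)) - ((1 - (x ^ 2 + (1 - x) * ρ)) * (1 - g)) := by
  have h1x : 0 < 1 - x := sub_pos.2 hx1
  have hg0 : 0 < g := hx0.trans_le hxg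
  have hgam : 0 < x ^ 2 + (1 - x) * ρ := by nlinarith [mul_pos h1x hr0, pow_pos hx0 2]
  have hgam1 : x ^ 2 + (1 - x) * ρ < 1 := by nlinarith [mul_lt_mul_of_pos_left hrx h1x]
  have hC0 : 0 < ρ * D + a * g := by nlinarith [mul_pos hr0 hD0, mul_pos ha0 hg0]
  have hrD : ρ * D < x * D := mul_lt_mul_of_pos_right hrx hD0
  have hxD : x * D < D := by nlinarith
  have hag : a * g ≤ a := by nlinarith
  have hax : x * a ≤ a * g := by nlinarith
  have key := SliceLawSWCert.poly_S_inc_H x ρ g a D (by linarith) (by linarith) (by linarith) (by linarith) (by linarith) (by linarith) (by linarith) (by linarith) (by linarith) (by linarith)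
  have e : (((x ^ 2 + (1 - x) * ρ) * (1 - g)) / ((ρ * D + a * g) / (D - (ρ * D + a * g))) + ((x ^ 2 + (1 - x) * ρ) * g) / (x / (1 - x)) - ((1 - (x ^ 2 + (1 - x) * ρ)) * (1 - g))) * (x * (ρ * D + a * g))
      = -x^3 * ρ * g * D - x^3 * g^2 * a - x^3 * g * D + x^3 * D + x^2 * ρ^2 * g * D + x^2 * ρ * g^2 * a + 2 * x^2 * ρ * g * D - x^2 * ρ * D + x^2 * g^2 * a - 2 * x * ρ^2 * g * D - 2 * x * ρ * g^2 * a + x * g^2 * a - x * g * a + ρ^2 * g * D + ρ * g^2 * a := by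
    set C := ρ * D + a * g with hCdef
    set E := D - C with hEdef
    have hCne : C ≠ 0 := ne_of_gt hC0
    have hEne : E ≠ 0 := ne_of_gt (by rw [hEdef, hCdef]; linarith)
    have h1xne : (1:ℝ) - x ≠ 0 := h1x.ne'
    have hxne : x ≠ 0 := hx0.ne'
    have hane : a ≠ 0 := ha0.ne'
    field_simp
    simp only [hEdef, hCdef]
    ring
  have hDEN : 0 < (x * (ρ * D + a * g)) := mul_pos hx0 hC0
  exact (mul_nonneg_iff_of_pos_right hDEN).1 (by rw [e]; exact key)

set_option maxHeartbeats 4000000 in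
set_option maxRecDepth 100000 in
/-- **cell S_H_inc (shallow, `C < a` so `l + a` absorbs at the heavy rate `C/(a − C)`, `D ≤ C`): `m₀ ≤ m₁/u_{01} + m_G/(x/(1−x))`.** [this work] -/
theorem sw_S_H_inc (hx0 : 0 < x) (hx1 : x < 1) (hr0 : 0 < ρ) (hrx : ρ < x) (hxg : x ≤ g) (_hg1 : g ≤ 1) (ha0 : 0 < a) (hD0 : 0 < D)
    (_hmidW : ρ * D + a * g ≤ 2 * D) (_hsh : ρ * D + a * g ≤ 2 * a) (hCa : ρ * D + a * g < a) (hCD : D ≤ ρ * D + a * g) :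
    0 ≤ ((1 - (x ^ 2 + (1 - x) * ρ)) * g) / ((ρ * D + a * g) / (a - (ρ * D + a * g))) + ((x ^ 2 + (1 - x) * ρ) * g) / (x / (1 - x)) - ((1 - (x ^ 2 + (1 - x) * ρ)) * (1 - g)) := by
  have h1x : 0 < 1 - x := sub_pos.2 hx1
  have hg0 : 0 < g := hx0.trans_le hxg
  have hgam : 0 < x ^ 2 + (1 - x) * ρ := by nlinarith [mul_pos h1x hr0, pow_pos hx0 2]
  have hgam1 : x ^ 2 + (1 - x) * ρ < 1 := by nlinarith [mul_lt_mul_of_pos_left hrx h1x]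
  have hC0 : 0 < ρ * D + a * g := by nlinarith [mul_pos hr0 hD0, mul_pos ha0 hg0]
  have hrD : ρ * D < x * D := mul_lt_mul_of_pos_right hrx hD0
  have hxD : x * D < D := by nlinarith
  have hax : x * a ≤ a * g := by nlinarith
  have key := SliceLawSWCert.poly_S_H_inc x ρ g a D (by linarith) (by linarith) (by linarith) (by linarith) (by linarith) (by linarith) (by linarith) (by linarith)
  have e : (((1 - (x ^ 2 + (1 - x) * ρ)) * g) / ((ρ * D + a * g) / (a - (ρ * D + a * g))) + ((x ^ 2 + (1 - x) * ρ) * g) / (x / (1 - x)) - ((1 - (x ^ 2 + (1 - x) * ρ)) * (1 - g))) * (x * (ρ * D + a * g))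
      = -x^3 * ρ * g * D + x^3 * ρ * D - x^3 * g^2 * a + x^2 * ρ^2 * g * D - x^2 * ρ^2 * D + x^2 * ρ * g^2 * a + x^2 * ρ * g * D + x^2 * g^2 * a - 2 * x * ρ^2 * g * D + x * ρ^2 * D - 2 * x * ρ * g^2 * a - x * ρ * D + ρ^2 * g * D + ρ * g^2 * a := by
    set C := ρ * D + a * g with hCdef
    set A1 := a - C with hA1def
    have hCne : C ≠ 0 := ne_of_gt hC0
    have hA1ne : A1 ≠ 0 := ne_of_gt (by rw [hA1def, hCdef]; linarith)
    have h1xne : (1:ℝ) - x ≠ 0 := h1x.ne'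
    have hxne : x ≠ 0 := hx0.ne'
    have hane : a ≠ 0 := ha0.ne'
    field_simp
    simp only [hA1def, hCdef]
    ring
  have hDEN : 0 < (x * (ρ * D + a * g)) := mul_pos hx0 hC0
  exact (mul_nonneg_iff_of_pos_right hDEN).1 (by rw [e]; exact key)

set_option maxHeartbeats 4000000 in
set_option maxRecDepth 100000 in
/-- **cell S_H_L (shallow, `C < a`, `(l,h)` light at `T′`, full transfer): `m₀ ≤ m₁/u_{01} + γ/u_{0d}`.** [this work] -/
theorem sw_S_H_L (hx0 : 0 < x) (hx1 : x < 1) (hr0 : 0 < ρ) (hrx : ρ < x) (hxg : x ≤ g) (_hg1 : g ≤ 1) (ha0 : 0 < a) (hD0 : 0 < D)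
    (_hmidW : ρ * D + a * g ≤ 2 * D) (_hsh : ρ * D + a * g ≤ 2 * a) (hCa : ρ * D + a * g < a) (hside : ρ * D + a * g ≤ x * D) :
    0 ≤ ((1 - (x ^ 2 + (1 - x) * ρ)) * g) / ((ρ * D + a * g) / (a - (ρ * D + a * g))) + (x ^ 2 + (1 - x) * ρ) / ((x ^ 2 * D + (1 - x) * (ρ * D + a * g)) / ((1 - x) * ((1 + x) * D - (ρ * D + a * g)))) - ((1 - (x ^ 2 + (1 - x) * ρ)) * (1 - g)) := by
  have h1x : 0 < 1 - x := sub_pos.2 hx1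
  have hg0 : 0 < g := hx0.trans_le hxg
  have hgam : 0 < x ^ 2 + (1 - x) * ρ := by nlinarith [mul_pos h1x hr0, pow_pos hx0 2]
  have hgam1 : x ^ 2 + (1 - x) * ρ < 1 := by nlinarith [mul_lt_mul_of_pos_left hrx h1x]
  have hC0 : 0 < ρ * D + a * g := by nlinarith [mul_pos hr0 hD0, mul_pos ha0 hg0]
  have hrD : ρ * D < x * D := mul_lt_mul_of_pos_right hrx hD0
  have hxD : x * D < D := by nlinarith
  have hax : x * a ≤ a * g := by nlinarith
  have key := SliceLawSWCert.poly_S_H_L x ρ g a D ha0.le (by linarith) (by linarith) (by linarith) (by linarith) (by linarith) (by linarith) (by linarith)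
  have e : (((1 - (x ^ 2 + (1 - x) * ρ)) * g) / ((ρ * D + a * g) / (a - (ρ * D + a * g))) + (x ^ 2 + (1 - x) * ρ) / ((x ^ 2 * D + (1 - x) * (ρ * D + a * g)) / ((1 - x) * ((1 + x) * D - (ρ * D + a * g)))) - ((1 - (x ^ 2 + (1 - x) * ρ)) * (1 - g))) * ((ρ * D + a * g) * (x ^ 2 * D + (1 - x) * (ρ * D + a * g)))
      = -x^4 * g * a * D + 2 * x^3 * ρ * g * a * D + x^3 * g^2 * a^2 - x^2 * ρ^2 * g * a * D - x^2 * ρ * g^2 * a^2 - 2 * x^2 * ρ * g * a * D - x^2 * g^2 * a^2 + x^2 * g * a * D + 2 * x * ρ^2 * g * a * D + 2 * x * ρ * g^2 * a^2 - ρ^2 * g * a * D - ρ * g^2 * a^2 := by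
    set C := ρ * D + a * g with hCdef
    set A1 := a - C with hA1def
    set N0 := x ^ 2 * D + (1 - x) * C with hN0def
    set L0 := (1 + x) * D - C with hL0def
    have hCne : C ≠ 0 := ne_of_gt hC0
    have hA1ne : A1 ≠ 0 := ne_of_gt (by rw [hA1def, hCdef]; linarith)
    have hN0ne : N0 ≠ 0 := ne_of_gt (by rw [hN0def, hCdef]; nlinarith [mul_pos (pow_pos hx0 2) hD0, mul_pos h1x hC0])
    have hL0ne : L0 ≠ 0 := ne_of_gt (by rw [hL0def, hCdef]; nlinarith [mul_pos hx0 hD0])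
    have h1xne : (1:ℝ) - x ≠ 0 := h1x.ne'
    have hxne : x ≠ 0 := hx0.ne'
    have hane : a ≠ 0 := ha0.ne'
    field_simp
    simp only [hA1def, hN0def, hL0def, hCdef]
    ring
  have hDEN : 0 < ((ρ * D + a * g) * (x ^ 2 * D + (1 - x) * (ρ * D + a * g))) := mul_pos hC0 (by nlinarith [mul_pos (pow_pos hx0 2) hD0, mul_pos h1x hC0])
  exact (mul_nonneg_iff_of_pos_right hDEN).1 (by rw [e]; exact key)

set_option maxHeartbeats 4000000 in
set_option maxRecDepth 100000 in
/-- **cell S_H_H (shallow, `C < a`, `(l,h)` heavy at `T′`, no transfer): `m₀ ≤ m₁/u_{01} + m_d/u_{0d} + m_G/(x/(1−x))`.** [this work] -/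
theorem sw_S_H_H (hx0 : 0 < x) (hx1 : x < 1) (hr0 : 0 < ρ) (hrx : ρ < x) (hxg : x ≤ g) (_hg1 : g ≤ 1) (ha0 : 0 < a) (hD0 : 0 < D)
    (_hmidW : ρ * D + a * g ≤ 2 * D) (_hsh : ρ * D + a * g ≤ 2 * a) (hCa : ρ * D + a * g < a) (hCD : ρ * D + a * g < D) (hside : x * D ≤ ρ * D + a * g) :
    0 ≤ ((1 - (x ^ 2 + (1 - x) * ρ)) * g) / ((ρ * D + a * g) / (a - (ρ * D + a * g))) + ((x ^ 2 + (1 - x) * ρ) * (1 - g)) / ((ρ * D + a * g) / (D - (ρ * D + a * g))) + ((x ^ 2 + (1 - x) * ρ) * g) / (x / (1 - x)) - ((1 - (x ^ 2 + (1 - x) * ρ)) * (1 - g)) := by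
  have h1x : 0 < 1 - x := sub_pos.2 hx1
  have hg0 : 0 < g := hx0.trans_le hxg
  have hgam : 0 < x ^ 2 + (1 - x) * ρ := by nlinarith [mul_pos h1x hr0, pow_pos hx0 2]
  have hgam1 : x ^ 2 + (1 - x) * ρ < 1 := by nlinarith [mul_lt_mul_of_pos_left hrx h1x]
  have hC0 : 0 < ρ * D + a * g := by nlinarith [mul_pos hr0 hD0, mul_pos ha0 hg0]
  have hrD : ρ * D < x * D := mul_lt_mul_of_pos_right hrx hD0
  have hxD : x * D < D := by nlinarith
  have hax : x * a ≤ a * g := by nlinarith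
  have key := SliceLawSWCert.poly_S_H_H x ρ g a D (by linarith) (by linarith) (by linarith) (by linarith) (by linarith) (by linarith) (by linarith)
  have e : (((1 - (x ^ 2 + (1 - x) * ρ)) * g) / ((ρ * D + a * g) / (a - (ρ * D + a * g))) + ((x ^ 2 + (1 - x) * ρ) * (1 - g)) / ((ρ * D + a * g) / (D - (ρ * D + a * g))) + ((x ^ 2 + (1 - x) * ρ) * g) / (x / (1 - x)) - ((1 - (x ^ 2 + (1 - x) * ρ)) * (1 - g))) * (x * (ρ * D + a * g))
      = -x^3 * g * a - x^3 * g * D + x^3 * D + x^2 * ρ * g * a + 2 * x^2 * ρ * g * D - x^2 * ρ * D + x^2 * g^2 * a - x * ρ^2 * g * D - x * ρ * g^2 * a - x * ρ * g * a - x * ρ * g * D + ρ^2 * g * D + ρ * g^2 * a := by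
    set C := ρ * D + a * g with hCdef
    set A1 := a - C with hA1def
    set E := D - C with hEdef
    have hCne : C ≠ 0 := ne_of_gt hC0
    have hA1ne : A1 ≠ 0 := ne_of_gt (by rw [hA1def, hCdef]; linarith)
    have hEne : E ≠ 0 := ne_of_gt (by rw [hEdef, hCdef]; linarith)
    have h1xne : (1:ℝ) - x ≠ 0 := h1x.ne'
    have hxne : x ≠ 0 := hx0.ne'
    have hane : a ≠ 0 := ha0.ne'
    field_simp
    simp only [hA1def, hEdef, hCdef]
    ring
  have hDEN : 0 < (x * (ρ * D + a * g)) := mul_pos hx0 hC0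
  exact (mul_nonneg_iff_of_pos_right hDEN).1 (by rw [e]; exact key)

end Cells

end LawDec

end Quant

end Summit.CriticalPhenomena.PercolationContinuityZ3.Theorems
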